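import Literature.Geometry.Kaehler.ComplexTorusIntegralHodgeLatticeLefschetzImage
import HarnessLib

/-!
# The complete integral Lefschetz decomposition of the Hodge lattice with ONE denominator:
# `N · Hdgᵖ(X, ℤ) ⊆ ⊕_{i ≤ p} θ^{p−i} ∧ Hdgⁱ(X, ℤ)_prim`

Layer `Literature/Geometry/Kaehler`, namespace `Literature.Geometry.Kaehler.ComplexTorus`; lane `lit-hodgefound`
(Track 2 foundations library), seat p09, generation 47, row g47-#2. THEOREMS ONLY (0 definitions); no named fact, net debt 0.
Sequel of g47-#1 (`ComplexTorusIntegralHodgeLatticeLefschetzImage`), whose data-free theorem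
`IsPolarizationType.exists_forall_nsmul_eq_primitive_add_wedge_ofRealForm` is ONE Lefschetz step with a uniform multiplier:
`N·x = y₀ + β ∧ θ` for every `x ∈ Hdgᵖ⁺¹(X, ℤ)` (`y₀` primitive integral Hodge, `β ∈ Hdgᵖ(X, ℤ)`). Iterating it down to `Hdg⁰(X, ℤ) = ℤ·1`
gives the COMPLETE decomposition of Lange's (5.22) / Voisin's Rem. 6.27 for the integral Hodge classes of a polarised abelian variety
(`g = j + 2`, type `(d₁, …, d_g)`, `θ = η_ℂ`), with bounded denominators:

* §1 **`IsPolarizationType.exists_forall_nsmul_eq_sum_lefschetzPow_primitive`**: for `2p ≤ g` there is ONE `N ≥ 1` such that every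
  `x ∈ Hdgᵖ(X, ℤ) = H^{2p}(X, ℤ) ∩ H^{p,p}` satisfies **`N·x = Σ_{i ≤ p} θ^{∧(p−i)} ∧ yᵢ`** with `yᵢ ∈ Hdgⁱ(X, ℤ)` PRIMITIVE (`yᵢ ∈ P^{2i}`) — stated
  subtraction-free: `N·x = Σ_{i ≤ p} zᵢ`, `zᵢ = Lˢ yᵢ` for some `s` with `2s + 2i = 2p` (`L = lefschetzPow η`, the tree's bundled Lefschetz
  operator). Over `ℚ` this is the Lefschetz decomposition of the Hodge classes `Bᵖ(X) = ⊕_{i ≤ p} L^{p−i} Bⁱ(X)_prim` (the primitive components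
  of a Hodge class are Hodge classes); over `ℤ` the sum `⊕ L^{p−i} Hdgⁱ(X, ℤ)_prim ⊆ Hdgᵖ(X, ℤ)` has finite index (Lange (5.22)) and `N` kills
  the quotient. (`…_of_add_eq` is the same statement in degree `k = p + p` with pieces in degree `m = i + i`.)
* §2 **`IsPolarizationType.exists_forall_nsmul_mem_of_lefschetzPow_one_mem`** — THE REDUCTION TO PRIMITIVE CLASSES, OVER `ℤ` UP TO `N`: for
  every family of subgroups `A_k ⊆ Hᵏ(X, ℂ)` stable under `L` (`y ∈ A_m ⟹ L y ∈ A_{m+2}`) and containing the primitive integral Hodge classes of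
  codimension `≤ p`, **`N · Hdgᵖ(X, ℤ) ⊆ A_{2p}`** with the SAME `N` (independent of `A`); e.g. `A` = the classes of algebraic / analytic cycles.
* §3 **`IsPolarizationType.exists_forall_nsmul_eq_zsmul_wedgePow_of_forall_primitive_eq_zero`**: if `X` has NO non-zero primitive integral Hodge
  classes in codimensions `1, …, p`, then **`N·x ∈ ℤ·θ^{∧p}` for every `x ∈ Hdgᵖ(X, ℤ)`** (every integral Hodge class of codimension `p` is a
  rational multiple of `θ^{∧p}` with denominator dividing `N`; the lattice form of the conclusion `Bᵖ(X) = ℚθᵖ`).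

## References

* [cite: VoisinHodgeI2002, §6.2.3 Lemma 6.26, Rem. 6.27 (PDF p. 126); §6.3.2 Lemma 6.31 (PDF p. 128); §7.1.2 (PDF p. 134)]
* [cite: Lange2023AbelianVarietiesComplex, §5.4.1 Thm. 5.4.2 and (5.22)–(5.23) (PDF p. 275); §7.3.2 (1), (3); §7.2.2]
* [cite: Kitaoka1993, Ch. 5 Prop. 5.3.3 (proof)]
* [cite: Huybrechts2005, Prop. 1.2.30]
-/

noncomputable section

-- `Module ℂ` / `SMulZeroClass ℂ` synthesis on `E [⋀^Fin k]→L[ℝ] ℂ` (as in `ComplexTorusLefschetzDecomposition`)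
set_option maxSynthPendingDepth 3

open Module Function Complex
open LinearMap (BilinForm)
open Literature.LinearAlgebra.Alternating
open Literature.Analysis.Complex (IsOfTypeAt typeSubmodule oneForm₀ oneForm₀_apply)

namespace Literature.Geometry.Kaehler.ComplexTorus

/-! ## §0 Form-level helpers -/

section Helpers

variable {E : Type*} [NormedAddCommGroup E] [NormedSpace ℂ E]

/-- A form of degree `2·0` is primitive for any `η` (`θ^{∧(g+1)} = 0` in real dimension `2g`). [cite: Huybrechts2005, Prop. 1.2.30] -/
private theorem mem_primitiveForms_zero₈₂ [FiniteDimensional ℂ E] (η : E [⋀^Fin 2]→L[ℝ] ℝ) (c : E [⋀^Fin 0]→L[ℝ] ℂ) :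
    c ∈ primitiveForms η 0 := by
  rw [mem_primitiveForms_iff]
  rw [eq_zero_of_finrank_real_lt (wedgePow (ofRealForm η) (finrank ℂ E - 0 + 1))
    (by rw [finrank_real_of_complex]; omega), ContinuousAlternatingMap.zero_wedge]

/-- `(Σᵢ zᵢ) ∧ θ = Σᵢ (zᵢ ∧ θ)`. [folklore] -/
private theorem sum_wedge₈₂ {m : ℕ} (θ : E [⋀^Fin 2]→L[ℝ] ℂ) (s : Finset ℕ) (z : ℕ → (E [⋀^Fin m]→L[ℝ] ℂ)) :
    (∑ i ∈ s, z i).wedge θ = ∑ i ∈ s, (z i).wedge θ :=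
  map_sum (AddMonoidHom.mk' (fun x : E [⋀^Fin m]→L[ℝ] ℂ ↦ x.wedge θ) (fun x y ↦ ContinuousAlternatingMap.wedge_add_left x y θ)) z s

/-- `L^{r₁} = L^{r₂}` for `r₁ = r₂` (transport of the degree bookkeeping). [folklore] -/
private theorem lefschetzPow_congr₈₂ (η : E [⋀^Fin 2]→L[ℝ] ℝ) {r₁ r₂ m k : ℕ} (hr : r₁ = r₂) (h₁ : 2 * r₁ + m = k) (h₂ : 2 * r₂ + m = k)
    (y : E [⋀^Fin m]→L[ℝ] ℂ) : lefschetzPow η r₁ h₁ y = lefschetzPow η r₂ h₂ y := by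
  subst hr
  rfl

/-- `Lᵖ 1 = θ^{∧p}` (`θ^{∧p} ∧ 1 = θ^{∧p}`). [cite: Lange2023AbelianVarietiesComplex, §7.3.2] -/
private theorem lefschetzPow_oneForm₀₈₂ (η : E [⋀^Fin 2]→L[ℝ] ℝ) (p : ℕ) (h : 2 * p + 0 = 2 * p) :
    lefschetzPow η p h (oneForm₀ E) = wedgePow (ofRealForm η) p := by
  rw [lefschetzPow_apply, wedge_zeroForm_eq_smul, oneForm₀_apply, one_smul]
  rfl

/-- A family of subgroups `A_k ⊆ Hᵏ(X, ℂ)` stable under one Lefschetz step is stable under all Lefschetz powers: `y ∈ A_m ⟹ Lˢ y ∈ A_{2s+m}`.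
[cite: Lange2023AbelianVarietiesComplex, §7.3.2 (1)] -/
theorem lefschetzPow_mem_of_forall_lefschetzPow_one_mem (η : E [⋀^Fin 2]→L[ℝ] ℝ) (A : (k : ℕ) → AddSubgroup (E [⋀^Fin k]→L[ℝ] ℂ))
    (hA : ∀ (m k : ℕ) (h : 2 * 1 + m = k) (y : E [⋀^Fin m]→L[ℝ] ℂ), y ∈ A m → lefschetzPow η 1 h y ∈ A k) :
    ∀ (s m k : ℕ) (h : 2 * s + m = k) (y : E [⋀^Fin m]→L[ℝ] ℂ), y ∈ A m → lefschetzPow η s h y ∈ A k := by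
  intro s
  induction s with
  | zero =>
    intro m k h y hy
    obtain rfl : m = k := by omega
    rw [lefschetzPow_zero_apply]
    exact hy
  | succ s ih =>
    intro m k h y hy
    have h1 : 2 * 1 + (2 * s + m) = k := by omega
    rw [lefschetzPow_congr₈₂ η (Nat.add_comm s 1) h (by omega) y, ← lefschetzPow_lefschetzPow η 1 s rfl h1 y]
    exact hA _ _ h1 _ (ih m (2 * s + m) rfl y hy)

end Helpers

/-! ## §1 The complete decomposition with one denominator -/

section Decomposition

variable {ι : Type*} [Fintype ι] [DecidableEq ι] {E : Type*} [NormedAddCommGroup E] [NormedSpace ℂ E]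
  {Φ : (ι → ℝ) ≃L[ℝ] E} {j p k : ℕ} {η : E [⋀^Fin 2]→L[ℝ] ℝ} {d : Fin (j + 2) → ℕ}

omit [Fintype ι] [DecidableEq ι] in
/-- `H⁰(X, ℤ) = ℤ·1`: an integral `0`-form is an integral multiple of the unit `0`-form. [cite: Lange2023AbelianVarietiesComplex, §1.3.1] -/
private theorem exists_eq_intCast_smul_oneForm₀₈₂ {β : E [⋀^Fin 0]→L[ℝ] ℂ} (hβ : β ∈ integralForms Φ 0) :
    ∃ c : ℤ, β = (c : ℂ) • oneForm₀ E := by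
  obtain ⟨c, hc⟩ := hβ Fin.elim0
  refine ⟨c, ?_⟩
  ext v
  rw [ContinuousAlternatingMap.smul_apply, oneForm₀_apply, smul_eq_mul, mul_one, Subsingleton.elim v (latticeTuple Φ Fin.elim0), hc]

omit [DecidableEq ι] in
/-- The induction engine of §1 (degree `k = p + p`, pieces in degree `m = i + i`; all data universally quantified in the order consumed by the
induction on `p`): the step `p → p + 1` is g47-#1's one-step theorem `N₂·x = y₀ + β ∧ θ` followed by the induction hypothesis on
`β ∈ Hdgᵖ(X, ℤ)` and `(Lˢ y) ∧ θ = L^{s+1} y`. [cite: VoisinHodgeI2002, §6.2.3 Rem. 6.27 (PDF p. 126); §6.3.2 Lemma 6.31] [cite: Lange2023AbelianVarietiesComplex, §5.4.1 (5.22)–(5.23) (PDF p. 275); §7.3.2 (3)] -/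
theorem IsPolarizationType.exists_forall_nsmul_eq_sum_lefschetzPow_primitive_of_add_eq (hd : IsPolarizationType Φ η d)
    (hη : IsRiemannForm Φ η) :
    ∀ p k : ℕ, p + p = k → k ≤ j + 2 →
      ∃ N : ℕ, 0 < N ∧ ∀ x ∈ integralHodgeClassesIn Φ k p, ∃ z : ℕ → (E [⋀^Fin k]→L[ℝ] ℂ),
        (N : ℂ) • x = ∑ i ∈ Finset.range (p + 1), z i ∧
        ∀ i ∈ Finset.range (p + 1), ∃ (s m : ℕ) (_ : i + i = m) (h : 2 * s + m = k) (y : E [⋀^Fin m]→L[ℝ] ℂ),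
          y ∈ integralHodgeClassesIn Φ m i ∧ y ∈ primitiveForms η m ∧ z i = lefschetzPow η s h y := by
  haveI : FiniteDimensional ℝ E := Module.Finite.equiv Φ.toLinearEquiv
  haveI : FiniteDimensional ℂ E := Module.Finite.of_restrictScalars_finite ℝ ℂ E
  intro p
  induction p with
  | zero =>
    intro k hpk _
    obtain rfl : k = 0 := by omega
    refine ⟨1, Nat.one_pos, fun x hx ↦ ⟨fun _ ↦ x, ?_, ?_⟩⟩
    · rw [zero_add, Finset.sum_range_one, Nat.cast_one, one_smul]
    · intro i hi
      rw [zero_add, Finset.mem_range, Nat.lt_one_iff] at hi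
      subst hi
      exact ⟨0, 0, rfl, rfl, x, hx, mem_primitiveForms_zero₈₂ η x, (lefschetzPow_zero_apply η _ x).symm⟩
  | succ p ih =>
    intro k hpk hk
    obtain rfl : k = 2 * p + 2 := by omega
    obtain ⟨N₁, hN₁, H₁⟩ := ih (2 * p) (by omega) (by omega)
    obtain ⟨q, hpq⟩ : ∃ q, 2 * p + 2 + q = j + 2 := ⟨j + 2 - (2 * p + 2), by omega⟩
    obtain ⟨N₂, hN₂, H₂⟩ := hd.exists_forall_nsmul_eq_primitive_add_wedge_ofRealForm hη hpq
    refine ⟨N₂ * N₁, Nat.mul_pos hN₂ hN₁, fun x hx ↦ ?_⟩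
    obtain ⟨y₀, hy₀H, hy₀P, β, hβH, hdec⟩ := H₂ x hx
    obtain ⟨z, hsum, hz⟩ := H₁ β hβH
    refine ⟨fun i ↦ if i = p + 1 then (N₁ : ℂ) • y₀ else (z i).wedge (ofRealForm η : E [⋀^Fin 2]→L[ℝ] ℂ), ?_, ?_⟩
    · -- `(N₂ N₁)·x = N₁·y₀ + (N₁·β) ∧ θ = N₁·y₀ + Σ_{i ≤ p} zᵢ ∧ θ`
      have hne : ∀ i ∈ Finset.range (p + 1),
          (if i = p + 1 then (N₁ : ℂ) • y₀ else (z i).wedge (ofRealForm η : E [⋀^Fin 2]→L[ℝ] ℂ)) =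
            (z i).wedge (ofRealForm η : E [⋀^Fin 2]→L[ℝ] ℂ) := fun i hi ↦ by
        rw [if_neg (Nat.ne_of_lt (Finset.mem_range.1 hi))]
      rw [Finset.sum_range_succ, Finset.sum_congr rfl hne, if_pos rfl, ← sum_wedge₈₂, ← hsum, wedge_smul_left_complex,
        show ((N₂ * N₁ : ℕ) : ℂ) = (N₁ : ℂ) * (N₂ : ℂ) by push_cast; ring, mul_smul, hdec, smul_add]
      exact add_comm _ _
    · intro i hi
      by_cases hip : i = p + 1
      · subst hip
        refine ⟨0, 2 * p + 2, by omega, by omega, (N₁ : ℂ) • y₀, ?_, ?_, ?_⟩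
        · rw [Nat.cast_smul_eq_nsmul]
          exact AddSubgroup.nsmul_mem _ hy₀H N₁
        · exact (primitiveForms η (2 * p + 2)).smul_mem _ ((hd.mem_primitiveForms_iff_wedgePow_wedge_eq_zero hpq y₀).2 hy₀P)
        · simp only [if_true]
          rw [lefschetzPow_zero_apply]
      · have hi' : i ∈ Finset.range (p + 1) := by
          rw [Finset.mem_range] at hi ⊢
          omega
        obtain ⟨s, m, hm, h, y, hyH, hyP, hzi⟩ := hz i hi'
        refine ⟨1 + s, m, hm, by omega, y, hyH, hyP, ?_⟩
        simp only [if_neg hip]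
        rw [hzi, ← lefschetzPow_one_eq_wedge_ofRealForm η (show 2 * 1 + 2 * p = 2 * p + 2 by omega) (lefschetzPow η s h y),
          lefschetzPow_lefschetzPow]

omit [DecidableEq ι] in
/-- **THE COMPLETE INTEGRAL LEFSCHETZ DECOMPOSITION OF THE HODGE LATTICE, WITH ONE DENOMINATOR.** Let `X` be a polarised abelian variety of
dimension `g = j + 2`, `θ` its polarisation, `2p ≤ g`. There is an integer `N ≥ 1` such that EVERY integral Hodge class
`x ∈ Hdgᵖ(X, ℤ) = H^{2p}(X, ℤ) ∩ H^{p,p}` satisfies **`N·x = Σ_{i ≤ p} θ^{∧(p−i)} ∧ yᵢ` with `yᵢ ∈ Hdgⁱ(X, ℤ)` primitive** (`yᵢ ∈ H^{2i}(X, ℤ) ∩ H^{i,i} ∩ P^{2i}`):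
`N·x = Σ_{i ≤ p} zᵢ`, `zᵢ = Lˢ yᵢ` with `2s + 2i = 2p`. This is the Lefschetz decomposition of the Hodge classes
`Bᵖ(X) = ⊕_{i ≤ p} L^{p−i} Bⁱ(X)_prim` (Voisin Rem. 6.27, Lange §7.3.2 (3): `L` has bidegree `(1, 1)`, so the primitive components of a Hodge class are
Hodge classes) read on the LATTICE, where `⊕_{i ≤ p} L^{p−i} Hdgⁱ(X, ℤ)_prim ⊆ Hdgᵖ(X, ℤ)` is a sublattice of finite index (Lange (5.22)): the ONE
integer `N` (a product of the indices `[Hdgⁱ⁺¹(X, ℤ) : θ ∧ Hdgⁱ(X, ℤ) ⊕ Hdgⁱ⁺¹(X, ℤ)_prim]` of g47-#1) clears all denominators at once.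
[cite: VoisinHodgeI2002, §6.2.3 Lemma 6.26, Rem. 6.27 (PDF p. 126); §7.1.2 (PDF p. 134)] [cite: Lange2023AbelianVarietiesComplex, §7.3.2 (3); §5.4.1 Thm. 5.4.2 and (5.22)–(5.23) (PDF p. 275); §7.2.2] [cite: Kitaoka1993, Ch. 5 Prop. 5.3.3 (proof)] -/
theorem IsPolarizationType.exists_forall_nsmul_eq_sum_lefschetzPow_primitive (hd : IsPolarizationType Φ η d)
    (hη : IsRiemannForm Φ η) (hp : 2 * p ≤ j + 2) :
    ∃ N : ℕ, 0 < N ∧ ∀ x ∈ integralHodgeClassesIn Φ (2 * p) p, ∃ z : ℕ → (E [⋀^Fin (2 * p)]→L[ℝ] ℂ),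
      (N : ℂ) • x = ∑ i ∈ Finset.range (p + 1), z i ∧
      ∀ i ∈ Finset.range (p + 1), ∃ (s : ℕ) (h : 2 * s + 2 * i = 2 * p) (y : E [⋀^Fin (2 * i)]→L[ℝ] ℂ),
        y ∈ integralHodgeClassesIn Φ (2 * i) i ∧ y ∈ primitiveForms η (2 * i) ∧ z i = lefschetzPow η s h y := by
  obtain ⟨N, hN, H⟩ := hd.exists_forall_nsmul_eq_sum_lefschetzPow_primitive_of_add_eq hη p (2 * p) (by omega) hp
  refine ⟨N, hN, fun x hx ↦ ?_⟩
  obtain ⟨z, hsum, hz⟩ := H x hx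
  refine ⟨z, hsum, fun i hi ↦ ?_⟩
  obtain ⟨s, m, hm, h, y, hyH, hyP, hzi⟩ := hz i hi
  obtain rfl : m = 2 * i := by omega
  exact ⟨s, h, y, hyH, hyP, hzi⟩

end Decomposition

/-! ## §2 The reduction to primitive classes over `ℤ`, up to the uniform integer `N` -/

section Reduction

variable {ι : Type*} [Fintype ι] [DecidableEq ι] {E : Type*} [NormedAddCommGroup E] [NormedSpace ℂ E]
  {Φ : (ι → ℝ) ≃L[ℝ] E} {j p : ℕ} {η : E [⋀^Fin 2]→L[ℝ] ℝ} {d : Fin (j + 2) → ℕ}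

omit [DecidableEq ι] in
/-- **THE REDUCTION TO PRIMITIVE CLASSES, OVER `ℤ` UP TO A UNIFORM INTEGER.** For a polarised abelian variety (`g = j + 2`, `2p ≤ g`) there is
`N ≥ 1` — the denominator of the integral Lefschetz decomposition, INDEPENDENT of what follows — such that for EVERY family of subgroups
`A_k ⊆ Hᵏ(X, ℂ)` which is stable under the Lefschetz operator (`y ∈ A_m ⟹ L y = θ ∧ y ∈ A_{m+2}`) and contains the PRIMITIVE integral Hodge classes
`Hdgⁱ(X, ℤ) ∩ P^{2i}` for `i ≤ p`, one has **`N·x ∈ A_{2p}` for every integral Hodge class `x ∈ Hdgᵖ(X, ℤ)`**. (With `A` = the classes of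
algebraic cycles, which contain `θ` and are closed under cup product: if the primitive integral Hodge classes of codimension `≤ p` are algebraic,
then `N·Hdgᵖ(X, ℤ)` consists of algebraic classes — the Hodge conjecture for `X` in codimension `p` over `ℚ`, and over `ℤ` up to `N`.)
[cite: VoisinHodgeI2002, §6.2.3 Rem. 6.27 (PDF p. 126); §7.1.2 (PDF p. 134)] [cite: Lange2023AbelianVarietiesComplex, §7.3.2 (3); §5.4.1 (5.22)–(5.23) (PDF p. 275)] -/
theorem IsPolarizationType.exists_forall_nsmul_mem_of_lefschetzPow_one_mem (hd : IsPolarizationType Φ η d) (hη : IsRiemannForm Φ η)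
    (hp : 2 * p ≤ j + 2) :
    ∃ N : ℕ, 0 < N ∧ ∀ (A : (k : ℕ) → AddSubgroup (E [⋀^Fin k]→L[ℝ] ℂ)),
      (∀ (m k : ℕ) (h : 2 * 1 + m = k) (y : E [⋀^Fin m]→L[ℝ] ℂ), y ∈ A m → lefschetzPow η 1 h y ∈ A k) →
      (∀ i ≤ p, ∀ y ∈ integralHodgeClassesIn Φ (2 * i) i, y ∈ primitiveForms η (2 * i) → y ∈ A (2 * i)) →
      ∀ x ∈ integralHodgeClassesIn Φ (2 * p) p, (N : ℂ) • x ∈ A (2 * p) := by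
  obtain ⟨N, hN, H⟩ := hd.exists_forall_nsmul_eq_sum_lefschetzPow_primitive hη hp
  refine ⟨N, hN, fun A hA hprim x hx ↦ ?_⟩
  obtain ⟨z, hsum, hz⟩ := H x hx
  rw [hsum]
  refine sum_mem fun i hi ↦ ?_
  obtain ⟨s, h, y, hyH, hyP, hzi⟩ := hz i hi
  rw [hzi]
  exact lefschetzPow_mem_of_forall_lefschetzPow_one_mem η A hA s (2 * i) (2 * p) h y
    (hprim i (by have := Finset.mem_range.1 hi; omega) y hyH hyP)

omit [DecidableEq ι] in
/-- The same reduction with the integer multiple `N • x` (rather than the scalar `(N : ℂ) • x`). [cite: Lange2023AbelianVarietiesComplex, §7.3.2 (3); §5.4.1 (5.22)–(5.23) (PDF p. 275)] -/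
theorem IsPolarizationType.exists_forall_nsmul_mem_of_lefschetzPow_one_mem' (hd : IsPolarizationType Φ η d) (hη : IsRiemannForm Φ η)
    (hp : 2 * p ≤ j + 2) :
    ∃ N : ℕ, 0 < N ∧ ∀ (A : (k : ℕ) → AddSubgroup (E [⋀^Fin k]→L[ℝ] ℂ)),
      (∀ (m k : ℕ) (h : 2 * 1 + m = k) (y : E [⋀^Fin m]→L[ℝ] ℂ), y ∈ A m → lefschetzPow η 1 h y ∈ A k) →
      (∀ i ≤ p, ∀ y ∈ integralHodgeClassesIn Φ (2 * i) i, y ∈ primitiveForms η (2 * i) → y ∈ A (2 * i)) →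
      ∀ x ∈ integralHodgeClassesIn Φ (2 * p) p, N • x ∈ A (2 * p) := by
  obtain ⟨N, hN, H⟩ := hd.exists_forall_nsmul_mem_of_lefschetzPow_one_mem hη hp
  refine ⟨N, hN, fun A hA hprim x hx ↦ ?_⟩
  rw [← Nat.cast_smul_eq_nsmul ℂ N x]
  exact H A hA hprim x hx

end Reduction

/-! ## §3 No primitive integral Hodge classes in codimension `1, …, p` ⟹ `N · Hdgᵖ(X, ℤ) ⊆ ℤ·θ^{∧p}` -/

section NoPrimitive

variable {ι : Type*} [Fintype ι] [DecidableEq ι] {E : Type*} [NormedAddCommGroup E] [NormedSpace ℂ E]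
  {Φ : (ι → ℝ) ≃L[ℝ] E} {j p : ℕ} {η : E [⋀^Fin 2]→L[ℝ] ℝ} {d : Fin (j + 2) → ℕ}

omit [DecidableEq ι] in
/-- **If `X` has no non-zero primitive integral Hodge class in codimensions `1, …, p` (`2p ≤ g`), then `N·x ∈ ℤ·θ^{∧p}` for every
`x ∈ Hdgᵖ(X, ℤ)`, with ONE `N ≥ 1`**: all pieces of the integral Lefschetz decomposition vanish except `L^p Hdg⁰(X, ℤ) = ℤ·θ^{∧p}` (`H⁰(X, ℤ) = ℤ·1`,
`Lᵖ 1 = θ^{∧p}`). So every integral Hodge class of codimension `p` is a rational multiple `(c/N)·θ^{∧p}` — the lattice form of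
`Bᵖ(X) = ℚ·θᵖ` (e.g. `ρ(X) = 1` and no exotic classes up to codimension `p`). [cite: VoisinHodgeI2002, §6.2.3 Rem. 6.27 (PDF p. 126)] [cite: Lange2023AbelianVarietiesComplex, §7.3.2 (3); §5.4.1 (5.22) (PDF p. 275); §1.3.1] -/
theorem IsPolarizationType.exists_forall_nsmul_eq_zsmul_wedgePow_of_forall_primitive_eq_zero (hd : IsPolarizationType Φ η d)
    (hη : IsRiemannForm Φ η) (hp : 2 * p ≤ j + 2)
    (h0 : ∀ i, 1 ≤ i → i ≤ p → ∀ y ∈ integralHodgeClassesIn Φ (2 * i) i, y ∈ primitiveForms η (2 * i) → y = 0) :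
    ∃ N : ℕ, 0 < N ∧ ∀ x ∈ integralHodgeClassesIn Φ (2 * p) p, ∃ c : ℤ, (N : ℂ) • x = (c : ℂ) • wedgePow (ofRealForm η) p := by
  obtain ⟨N, hN, H⟩ := hd.exists_forall_nsmul_eq_sum_lefschetzPow_primitive_of_add_eq hη p (2 * p) (by omega) hp
  refine ⟨N, hN, fun x hx ↦ ?_⟩
  obtain ⟨z, hsum, hz⟩ := H x hx
  -- the pieces `i ≥ 1` vanish
  have hz0 : ∀ i ∈ Finset.range (p + 1), i ≠ 0 → z i = 0 := fun i hi hi0 ↦ by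
    obtain ⟨s, m, hm, h, y, hyH, hyP, hzi⟩ := hz i hi
    obtain rfl : m = 2 * i := by omega
    rw [hzi, h0 i (Nat.one_le_iff_ne_zero.2 hi0) (by have := Finset.mem_range.1 hi; omega) y hyH hyP, map_zero]
  rw [Finset.sum_eq_single_of_mem 0 (Finset.mem_range.2 (Nat.succ_pos p)) hz0] at hsum
  -- the piece `i = 0`: `y ∈ H⁰(X, ℤ) = ℤ·1`, `z₀ = Lᵖ (c·1) = c·θ^{∧p}`
  obtain ⟨s, m, hm, h, y, hyH, -, hz00⟩ := hz 0 (Finset.mem_range.2 (Nat.succ_pos p))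
  obtain rfl : m = 0 := by omega
  obtain rfl : s = p := by omega
  obtain ⟨c, rfl⟩ := exists_eq_intCast_smul_oneForm₀₈₂ (Φ := Φ) hyH.1
  refine ⟨c, ?_⟩
  rw [hsum, hz00, map_smul, lefschetzPow_oneForm₀₈₂]

end NoPrimitive

end Literature.Geometry.Kaehler.ComplexTorus

end
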